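import Literature.NumberTheory.CubicFields.HessianReduction
import Mathlib.Analysis.SpecialFunctions.Pow.Real
import HarnessLib

/-!
# Davenport's bound, positive discriminant: the fibres of the count of Hessian-reduced forms

`Proofs` file (theorems only), topic `Literature/NumberTheory/CubicFields`, continuing
`HessianReduction.lean`.  Towards the bound `O(X)` for the number of Hessian-reduced integral binary cubic
forms `(a, b, c, d)`, `a ≠ 0`, with `0 < Disc < X` (H. Davenport, *On the class-number of binary cubic
forms I*, J. London Math. Soc. 26 (1951): `Σ_{0<D≤X} h(D) = (π²/108) X + O(X^{15/16})`; we only prove an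
upper bound `O(X)`, organised as `Σ_a Σ_{(b,c)} #{d}`):

* `ncard_int_mem_Icc_le`, `ncard_int_affine_mem_Icc_le` — integers (in an arithmetic progression) in a
  real interval;
* `ncard_d_hessQ_le` — for fixed `(a, b, c)`, `#{d : |Q| ≤ P} ≤ 2P/(9|a|) + 1` (`Q = bc − 9ad`);
* `ncard_d_disc_le` — for fixed `(a, b, c)` with `4P³ > 27a²X`, `#{d : 0 < Disc < X} ≤ X/P^{3/2} + 2`
  (`27a² Disc = 4P³ − W²`, `W = 2b³ − 9abc + 27a²d`);
* `ncard_dFibre_le` — hence `#{d : (a,b,c,d) reduced, 0 < Disc < X} ≤ X^{2/5} |a|^{-3/5} + 2`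
  (stated with `y⁵ = X`, `β⁵ = |a|` to avoid real exponents).

## References

* H. Davenport, *On the class-number of binary cubic forms I*, J. London Math. Soc. 26 (1951)
  183–192 [Davenport1951CubicFormsI].
* K. Belabas, *A fast algorithm to compute cubic fields*, Math. Comp. 66 (1997), §§3, 5 [Belabas1997].
-/

noncomputable section

namespace Literature.NumberTheory.CubicFields

namespace BinaryCubic

open Finset

/-! ### Integers in real intervals -/

/-- The integers in `[u, v]` form the finite set `[⌈u⌉, ⌊v⌋]`. [folklore] -/
theorem int_mem_Icc_eq (u v : ℝ) : {d : ℤ | u ≤ d ∧ (d : ℝ) ≤ v} = ↑(Finset.Icc ⌈u⌉ ⌊v⌋) := by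
  ext d
  simp [Int.ceil_le, Int.le_floor]

/-- The number of integers in `[u, v]` is at most `max(v − u, 0) + 1`. [folklore] -/
theorem ncard_int_mem_Icc_le (u v : ℝ) :
    (({d : ℤ | u ≤ d ∧ (d : ℝ) ≤ v}).ncard : ℝ) ≤ max (v - u) 0 + 1 := by
  rw [int_mem_Icc_eq, Set.ncard_coe_finset, Int.card_Icc]
  rcases le_or_gt (⌊v⌋ + 1 - ⌈u⌉) 0 with h | h
  · rw [Int.toNat_of_nonpos h]
    simp only [CharP.cast_eq_zero]
    linarith [le_max_right (v - u) 0]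
  · have hc : (((⌊v⌋ + 1 - ⌈u⌉).toNat : ℕ) : ℝ) = ((⌊v⌋ + 1 - ⌈u⌉ : ℤ) : ℝ) := by
      have := Int.toNat_of_nonneg h.le
      exact_mod_cast this
    rw [hc]
    have h1 : (⌊v⌋ : ℝ) ≤ v := Int.floor_le v
    have h2 : u ≤ ⌈u⌉ := Int.le_ceil u
    push_cast
    linarith [le_max_left (v - u) 0]

/-- Solving `u ≤ k d + m ≤ v` for `d` when `k > 0`. [folklore] -/
theorem int_affine_mem_Icc_eq_of_pos {k : ℤ} (hk : 0 < k) (m : ℤ) (u v : ℝ) :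
    {d : ℤ | u ≤ ((k * d + m : ℤ) : ℝ) ∧ ((k * d + m : ℤ) : ℝ) ≤ v} =
      {d : ℤ | (u - m) / k ≤ d ∧ (d : ℝ) ≤ (v - m) / k} := by
  have hkR : (0 : ℝ) < k := by exact_mod_cast hk
  ext d
  simp only [Set.mem_setOf_eq, Int.cast_add, Int.cast_mul]
  rw [div_le_iff₀ hkR, le_div_iff₀ hkR]
  constructor <;> rintro ⟨h1, h2⟩ <;> constructor <;> linarith

/-- Solving `u ≤ k d + m ≤ v` for `d` when `k < 0`. [folklore] -/
theorem int_affine_mem_Icc_eq_of_neg {k : ℤ} (hk : k < 0) (m : ℤ) (u v : ℝ) :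
    {d : ℤ | u ≤ ((k * d + m : ℤ) : ℝ) ∧ ((k * d + m : ℤ) : ℝ) ≤ v} =
      {d : ℤ | (v - m) / k ≤ d ∧ (d : ℝ) ≤ (u - m) / k} := by
  have hkR : (k : ℝ) < 0 := by exact_mod_cast hk
  ext d
  simp only [Set.mem_setOf_eq, Int.cast_add, Int.cast_mul]
  rw [div_le_iff_of_neg hkR, le_div_iff_of_neg hkR]
  constructor <;> rintro ⟨h1, h2⟩ <;> constructor <;> linarith

/-- The integers `d` with `k d + m ∈ [u, v]` (`k ≠ 0`) form a finite set. [folklore] -/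
theorem finite_int_affine_mem_Icc {k : ℤ} (hk : k ≠ 0) (m : ℤ) (u v : ℝ) :
    {d : ℤ | u ≤ ((k * d + m : ℤ) : ℝ) ∧ ((k * d + m : ℤ) : ℝ) ≤ v}.Finite := by
  rcases lt_or_gt_of_ne hk with hk | hk
  · rw [int_affine_mem_Icc_eq_of_neg hk, int_mem_Icc_eq]; exact Finset.finite_toSet _
  · rw [int_affine_mem_Icc_eq_of_pos hk, int_mem_Icc_eq]; exact Finset.finite_toSet _

/-- The number of integers `d` with `k d + m ∈ [u, v]` (`k ≠ 0`) is at most `max((v − u)/|k|, 0) + 1`.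
[folklore] -/
theorem ncard_int_affine_mem_Icc_le {k : ℤ} (hk : k ≠ 0) (m : ℤ) (u v : ℝ) :
    (({d : ℤ | u ≤ ((k * d + m : ℤ) : ℝ) ∧ ((k * d + m : ℤ) : ℝ) ≤ v}).ncard : ℝ) ≤
      max ((v - u) / |(k : ℝ)|) 0 + 1 := by
  rcases lt_or_gt_of_ne hk with hk | hk
  · have hkR : (k : ℝ) < 0 := by exact_mod_cast hk
    rw [int_affine_mem_Icc_eq_of_neg hk]
    refine (ncard_int_mem_Icc_le _ _).trans ?_
    have : (u - m) / k - (v - m) / k = (v - u) / |(k : ℝ)| := by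
      rw [abs_of_neg hkR]; field_simp; ring
    rw [this]
  · have hkR : (0 : ℝ) < k := by exact_mod_cast hk
    rw [int_affine_mem_Icc_eq_of_pos hk]
    refine (ncard_int_mem_Icc_le _ _).trans ?_
    have : (v - m) / k - (u - m) / k = (v - u) / |(k : ℝ)| := by
      rw [abs_of_pos hkR]; field_simp; ring
    rw [this]

/-! ### The fibre in `d`: the `Q`-window and the discriminant window -/

/-- **`#{d : |Q| ≤ P} ≤ 2P/(9|a|) + 1`** for fixed `(a, b, c)`, `a ≠ 0` (`Q = bc − 9ad` runs over an
arithmetic progression of difference `9|a|` in `[−P, P]`). [cite: Davenport1951CubicFormsI, §3] -/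
theorem ncard_d_hessQ_le {a : ℤ} (ha : a ≠ 0) (b c : ℤ) {P : ℝ} (hP : 0 ≤ P) :
    (({d : ℤ | |((BinaryCubic.mk a b c d).hessQ : ℝ)| ≤ P}).ncard : ℝ) ≤ 2 * P / (9 * |(a : ℝ)|) + 1 := by
  have hk : (-9 * a : ℤ) ≠ 0 := by
    intro h; apply ha; linarith
  have hset : {d : ℤ | |((BinaryCubic.mk a b c d).hessQ : ℝ)| ≤ P} =
      {d : ℤ | -P ≤ (((-9 * a) * d + b * c : ℤ) : ℝ) ∧ (((-9 * a) * d + b * c : ℤ) : ℝ) ≤ P} := by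
    ext d
    simp only [Set.mem_setOf_eq, hessQ, abs_le]
    have : (b * c - 9 * a * d : ℤ) = -9 * a * d + b * c := by ring
    rw [this]
  rw [hset]
  refine (ncard_int_affine_mem_Icc_le hk (b * c) (-P) P).trans ?_
  have habs : |((-9 * a : ℤ) : ℝ)| = 9 * |(a : ℝ)| := by
    push_cast; rw [abs_mul, abs_neg]; norm_num
  have h2 : (P - -P) / (9 * |(a : ℝ)|) = 2 * P / (9 * |(a : ℝ)|) := by ring
  rw [habs, h2, max_eq_left (by positivity)]

/-- The set `{d : |Q| ≤ P}` is finite (`a ≠ 0`). [folklore] -/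
theorem finite_d_hessQ {a : ℤ} (ha : a ≠ 0) (b c : ℤ) (P : ℝ) :
    {d : ℤ | |((BinaryCubic.mk a b c d).hessQ : ℝ)| ≤ P}.Finite := by
  have hk : (-9 * a : ℤ) ≠ 0 := by
    intro h; apply ha; linarith
  have hset : {d : ℤ | |((BinaryCubic.mk a b c d).hessQ : ℝ)| ≤ P} =
      {d : ℤ | -P ≤ (((-9 * a) * d + b * c : ℤ) : ℝ) ∧ (((-9 * a) * d + b * c : ℤ) : ℝ) ≤ P} := by
    ext d
    simp only [Set.mem_setOf_eq, hessQ, abs_le]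
    have : (b * c - 9 * a * d : ℤ) = -9 * a * d + b * c := by ring
    rw [this]
  rw [hset]
  exact finite_int_affine_mem_Icc hk _ _ _

/-- `27a² Disc = 4P³ − W²` with `W = 27a²d + (2b³ − 9abc)`, over `ℝ`. [folklore] -/
theorem disc_identity_real (a b c d : ℤ) :
    27 * (a : ℝ) ^ 2 * ((BinaryCubic.mk a b c d).disc : ℝ) =
      4 * ((b : ℝ) ^ 2 - 3 * a * c) ^ 3 - ((27 * a ^ 2 * d + (2 * b ^ 3 - 9 * a * b * c) : ℤ) : ℝ) ^ 2 := by
  simp only [disc_eq]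
  push_cast
  ring

/-- **`#{d : 0 < Disc < X} ≤ X/P^{3/2} + 2`** for fixed `(a, b, c)` with `a ≠ 0` and `4P³ > 27a²X`
(`27a² Disc = 4P³ − W²`, so `W = 27a²d + W₀` lies in one of the two intervals `√(4P³−27a²X) ≤ |W| ≤ 2P^{3/2}`,
each of length `≤ 27a²X/(2P^{3/2})`). [cite: Davenport1951CubicFormsI, §3] -/
theorem ncard_d_disc_le {a : ℤ} (ha : a ≠ 0) (b c : ℤ) {X : ℝ} (hX : 0 ≤ X) {P : ℝ}
    (hPdef : P = (b : ℝ) ^ 2 - 3 * a * c) (hP : 0 < P) (hbig : 27 * (a : ℝ) ^ 2 * X < 4 * P ^ 3) :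
    (({d : ℤ | 0 < (BinaryCubic.mk a b c d).disc ∧ ((BinaryCubic.mk a b c d).disc : ℝ) < X}).ncard : ℝ) ≤
      X / (P * Real.sqrt P) + 2 := by
  set k : ℤ := 27 * a ^ 2 with hk
  set m : ℤ := 2 * b ^ 3 - 9 * a * b * c with hm
  have ha2 : (0 : ℝ) < (a : ℝ) ^ 2 := by
    have : (a : ℝ) ≠ 0 := by exact_mod_cast ha
    positivity
  have hkR : (k : ℝ) = 27 * (a : ℝ) ^ 2 := by rw [hk]; push_cast; ring
  have hkpos : (0 : ℝ) < k := by rw [hkR]; positivity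
  have hk0 : k ≠ 0 := by
    intro h; rw [h, Int.cast_zero] at hkpos; exact lt_irrefl _ hkpos
  set L : ℝ := 4 * P ^ 3 - 27 * (a : ℝ) ^ 2 * X with hL
  have hL0 : 0 < L := by rw [hL]; linarith
  set T : ℝ := 2 * (P * Real.sqrt P) with hT
  have hsq : Real.sqrt P ^ 2 = P := Real.sq_sqrt hP.le
  have hPs : 0 < P * Real.sqrt P := by positivity
  have hT2 : T ^ 2 = 4 * P ^ 3 := by
    rw [hT]; nlinarith [hsq]
  have hT0 : 0 < T := by rw [hT]; positivity
  have hsL : Real.sqrt L ^ 2 = L := Real.sq_sqrt hL0.le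
  have hsL0 : 0 ≤ Real.sqrt L := Real.sqrt_nonneg L
  have hLT : Real.sqrt L ≤ T := by
    rw [← Real.sqrt_sq hT0.le]
    exact Real.sqrt_le_sqrt (by rw [hT2, hL]; nlinarith)
  -- the two windows
  set S₁ : Set ℤ := {d : ℤ | Real.sqrt L ≤ ((k * d + m : ℤ) : ℝ) ∧ ((k * d + m : ℤ) : ℝ) ≤ T} with hS₁
  set S₂ : Set ℤ := {d : ℤ | -T ≤ ((k * d + m : ℤ) : ℝ) ∧ ((k * d + m : ℤ) : ℝ) ≤ -Real.sqrt L} with hS₂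
  have hsub : {d : ℤ | 0 < (BinaryCubic.mk a b c d).disc ∧ ((BinaryCubic.mk a b c d).disc : ℝ) < X} ⊆
      S₁ ∪ S₂ := by
    intro d hd
    obtain ⟨hD0, hDX⟩ := hd
    have hD0' : (0 : ℝ) < ((BinaryCubic.mk a b c d).disc : ℝ) := by exact_mod_cast hD0
    set W : ℝ := ((k * d + m : ℤ) : ℝ) with hW
    have hid : 27 * (a : ℝ) ^ 2 * ((BinaryCubic.mk a b c d).disc : ℝ) = 4 * P ^ 3 - W ^ 2 := by
      have h0 := disc_identity_real a b c d
      push_cast at h0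
      rw [hPdef, hW, hk, hm]; push_cast
      linear_combination h0
    have h1 : W ^ 2 < T ^ 2 := by rw [hT2]; nlinarith
    have h2 : L < W ^ 2 := by
      have : 27 * (a : ℝ) ^ 2 * ((BinaryCubic.mk a b c d).disc : ℝ) < 27 * (a : ℝ) ^ 2 * X :=
        mul_lt_mul_of_pos_left hDX (by positivity)
      rw [hL]; linarith
    have hWT : |W| < T := abs_lt_of_sq_lt_sq h1 hT0.le
    have hLW : Real.sqrt L < |W| := by
      rw [← Real.sqrt_sq_eq_abs]
      exact Real.sqrt_lt_sqrt hL0.le h2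
    rcases le_or_gt 0 W with hW0 | hW0
    · left
      rw [abs_of_nonneg hW0] at hWT hLW
      exact ⟨hLW.le, hWT.le⟩
    · right
      rw [abs_of_neg hW0] at hWT hLW
      exact ⟨by linarith, by linarith⟩
  have hfin : (S₁ ∪ S₂).Finite :=
    (finite_int_affine_mem_Icc hk0 _ _ _).union (finite_int_affine_mem_Icc hk0 _ _ _)
  -- each window has at most `X/(2 P^{3/2}) + 1` points
  have hkey : max ((T - Real.sqrt L) / |(k : ℝ)|) 0 ≤ X / (2 * (P * Real.sqrt P)) := by
    refine max_le ?_ (by positivity)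
    rw [abs_of_pos hkpos, div_le_div_iff₀ hkpos (by positivity)]
    -- `(T − √L) · T ≤ k X` since `T² − L = kX` and `√L ≤ T`
    have hTL : T ^ 2 - L = (k : ℝ) * X := by rw [hT2, hL, hkR]; ring
    rw [← hT]
    nlinarith [mul_nonneg hsL0 (sub_nonneg.mpr hLT), hsL]
  have h₁ : ((S₁.ncard : ℕ) : ℝ) ≤ X / (2 * (P * Real.sqrt P)) + 1 :=
    (ncard_int_affine_mem_Icc_le hk0 m _ _).trans (by linarith)
  have h₂ : ((S₂.ncard : ℕ) : ℝ) ≤ X / (2 * (P * Real.sqrt P)) + 1 := by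
    refine (ncard_int_affine_mem_Icc_le hk0 m _ _).trans ?_
    have : -Real.sqrt L - -T = T - Real.sqrt L := by ring
    rw [this]; linarith
  calc (({d : ℤ | 0 < (BinaryCubic.mk a b c d).disc ∧ ((BinaryCubic.mk a b c d).disc : ℝ) < X}).ncard : ℝ)
      ≤ ((S₁ ∪ S₂).ncard : ℝ) := by exact_mod_cast Set.ncard_le_ncard hsub hfin
    _ ≤ (S₁.ncard : ℝ) + (S₂.ncard : ℝ) := by exact_mod_cast Set.ncard_union_le S₁ S₂
    _ ≤ X / (P * Real.sqrt P) + 2 := by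
        have : X / (P * Real.sqrt P) = 2 * (X / (2 * (P * Real.sqrt P))) := by
          field_simp
        rw [this]; linarith

/-- For fixed `(a, b, c)` with `a ≠ 0`, only finitely many `d` give positive discriminant
(`27a² Disc = 4P³ − W²`). [folklore] -/
theorem finite_d_disc_pos {a : ℤ} (ha : a ≠ 0) (b c : ℤ) :
    {d : ℤ | 0 < (BinaryCubic.mk a b c d).disc}.Finite := by
  set k : ℤ := 27 * a ^ 2 with hk
  set m : ℤ := 2 * b ^ 3 - 9 * a * b * c with hm
  have ha2 : (0 : ℝ) < (a : ℝ) ^ 2 := by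
    have : (a : ℝ) ≠ 0 := by exact_mod_cast ha
    positivity
  have hkR : (k : ℝ) = 27 * (a : ℝ) ^ 2 := by rw [hk]; push_cast; ring
  have hkpos : (0 : ℝ) < k := by rw [hkR]; positivity
  have hk0 : k ≠ 0 := by
    intro h; rw [h, Int.cast_zero] at hkpos; exact lt_irrefl _ hkpos
  set P : ℝ := (b : ℝ) ^ 2 - 3 * a * c with hP
  by_cases hPpos : 0 < P
  · set T : ℝ := 2 * (P * Real.sqrt P) with hT
    have hsq : Real.sqrt P ^ 2 = P := Real.sq_sqrt hPpos.le
    have hT2 : T ^ 2 = 4 * P ^ 3 := by rw [hT]; nlinarith [hsq]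
    have hT0 : 0 < T := by rw [hT]; positivity
    refine (finite_int_affine_mem_Icc hk0 m (-T) T).subset fun d hd => ?_
    have hD : (0 : ℝ) < ((BinaryCubic.mk a b c d).disc : ℝ) := by exact_mod_cast hd
    have hid : 27 * (a : ℝ) ^ 2 * ((BinaryCubic.mk a b c d).disc : ℝ) = 4 * P ^ 3 - ((k * d + m : ℤ) : ℝ) ^ 2 := by
      have h0 := disc_identity_real a b c d
      push_cast at h0
      rw [hP, hk, hm]; push_cast
      linear_combination h0
    have h1 : ((k * d + m : ℤ) : ℝ) ^ 2 < T ^ 2 := by rw [hT2]; nlinarith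
    have := abs_lt_of_sq_lt_sq h1 hT0.le
    exact ⟨(abs_lt.mp this).1.le, (abs_lt.mp this).2.le⟩
  · -- `P ≤ 0`: no `d` at all
    convert Set.finite_empty
    ext d
    simp only [Set.mem_setOf_eq, Set.mem_empty_iff_false, iff_false, not_lt]
    have hid : 27 * (a : ℝ) ^ 2 * ((BinaryCubic.mk a b c d).disc : ℝ) =
        4 * P ^ 3 - (((27 * a ^ 2 * d + (2 * b ^ 3 - 9 * a * b * c) : ℤ) : ℝ)) ^ 2 := by
      rw [hP]; exact disc_identity_real a b c d
    have hP3 : P ^ 3 ≤ 0 := by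
      have : P ≤ 0 := not_lt.mp hPpos
      nlinarith [sq_nonneg P]
    have : 27 * (a : ℝ) ^ 2 * ((BinaryCubic.mk a b c d).disc : ℝ) ≤ 0 := by nlinarith [sq_nonneg (((27 * a ^ 2 * d + (2 * b ^ 3 - 9 * a * b * c) : ℤ) : ℝ))]
    have hD : ((BinaryCubic.mk a b c d).disc : ℝ) ≤ 0 := by
      by_contra h
      push Not at h
      have := mul_pos (by positivity : (0 : ℝ) < 27 * (a : ℝ) ^ 2) h
      linarith
    exact_mod_cast hD

/-! ### The fibre in `d` of the reduced forms -/

/-- **The number of `d` completing `(a, b, c)` to a Hessian-reduced form with `0 < Disc < X` is at most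
`X^{2/5} |a|^{-3/5} + 2`** (stated with `y⁵ = X`, `β⁵ = |a|`): it is `≤ 2P/(9|a|) + 1`, and also
`≤ X/P^{3/2} + 2` once `4P³ > 27a²X`; reducedness gives `27a² ≤ 4P ≤ 4√X`, and the two bounds cross at
`P ≍ X^{2/5}|a|^{2/5}`. [cite: Davenport1951CubicFormsI, §3] -/
theorem ncard_dFibre_le {a : ℤ} (ha : a ≠ 0) (b c : ℤ) (X : ℕ) {y β : ℝ} (hy : 0 < y) (hyX : y ^ 5 = X)
    (hβ : 0 < β) (hβa : β ^ 5 = |(a : ℝ)|) :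
    (({d : ℤ | 0 < (BinaryCubic.mk a b c d).hessP ∧ |(BinaryCubic.mk a b c d).hessQ| ≤ (BinaryCubic.mk a b c d).hessP ∧
        (BinaryCubic.mk a b c d).hessP ≤ (BinaryCubic.mk a b c d).hessR ∧
        0 < (BinaryCubic.mk a b c d).disc ∧ (BinaryCubic.mk a b c d).disc < X}).ncard : ℝ) ≤
      y ^ 2 / β ^ 3 + 2 := by
  set S := {d : ℤ | 0 < (BinaryCubic.mk a b c d).hessP ∧ |(BinaryCubic.mk a b c d).hessQ| ≤ (BinaryCubic.mk a b c d).hessP ∧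
        (BinaryCubic.mk a b c d).hessP ≤ (BinaryCubic.mk a b c d).hessR ∧
        0 < (BinaryCubic.mk a b c d).disc ∧ (BinaryCubic.mk a b c d).disc < X} with hS
  rcases S.eq_empty_or_nonempty with hempty | ⟨d₀, hd₀⟩
  · rw [hempty, Set.ncard_empty, Nat.cast_zero]; positivity
  obtain ⟨hP0, hQ0, hR0, hD0, hDX0⟩ := hd₀
  -- `P = b² − 3ac` does not depend on `d`
  set Pz : ℤ := b ^ 2 - 3 * a * c with hPz
  have hPeq : ∀ d : ℤ, (BinaryCubic.mk a b c d).hessP = Pz := fun d => by simp [hessP, hPz]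
  set P : ℝ := (Pz : ℝ) with hPdef
  have hPdef' : P = (b : ℝ) ^ 2 - 3 * a * c := by rw [hPdef, hPz]; push_cast; ring
  have hPpos : 0 < P := by rw [hPdef]; exact_mod_cast (hPeq d₀ ▸ hP0)
  set α : ℝ := |(a : ℝ)| with hα
  have hα1 : 1 ≤ α := by
    rw [hα, ← Int.cast_abs]; exact_mod_cast Int.one_le_abs ha
  have hα0 : 0 < α := by linarith
  -- reducedness at `d₀`: `27a² ≤ 4P`, `P² ≤ Disc < X`
  have h27 : 27 * α ^ 2 ≤ 4 * P := by
    have := sq_a_le_of_reduced hP0 hQ0 hR0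
    rw [hPeq d₀] at this
    have h' : (27 * a ^ 2 : ℝ) ≤ 4 * P := by rw [hPdef]; exact_mod_cast this
    rw [hα, sq_abs]; exact h'
  have hPX : P ^ 2 < (X : ℝ) := by
    have h1 := hessP_sq_le_disc hQ0 hR0 hP0.le
    rw [hPeq d₀] at h1
    have h2 : ((Pz ^ 2 : ℤ) : ℝ) < ((X : ℤ) : ℝ) := by exact_mod_cast h1.trans_lt hDX0
    push_cast at h2
    rw [hPdef]; exact_mod_cast h2
  have hXy : (X : ℝ) = y ^ 5 := hyX.symm
  have hαβ : α = β ^ 5 := hβa.symm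
  -- `β⁴ < y` (from `α⁴ ≤ (4P/27)² < X`)
  have hβy : β ^ 4 < y := by
    have h1 : α ^ 4 < y ^ 5 := by
      rw [← hXy]
      have : α ^ 2 ≤ 4 * P / 27 := by linarith
      calc α ^ 4 = (α ^ 2) ^ 2 := by ring
        _ ≤ (4 * P / 27) ^ 2 := pow_le_pow_left₀ (by positivity) this 2
        _ ≤ P ^ 2 := by nlinarith
        _ < X := hPX
    rw [hαβ] at h1
    have h2 : (β ^ 4) ^ 5 < y ^ 5 := by
      calc (β ^ 4) ^ 5 = (β ^ 5) ^ 4 := by ring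
        _ < y ^ 5 := h1
    exact lt_of_pow_lt_pow_left₀ 5 hy.le h2
  -- the two bounds
  have hB1 : ((S.ncard : ℕ) : ℝ) ≤ 2 * P / (9 * α) + 1 := by
    have hsub : S ⊆ {d : ℤ | |((BinaryCubic.mk a b c d).hessQ : ℝ)| ≤ P} := by
      intro d hd
      obtain ⟨-, hQ, -, -, -⟩ := hd
      rw [hPeq d] at hQ
      have : ((|(BinaryCubic.mk a b c d).hessQ| : ℤ) : ℝ) ≤ P := by rw [hPdef]; exact_mod_cast hQ
      simpa [Int.cast_abs] using this
    calc ((S.ncard : ℕ) : ℝ) ≤ (({d : ℤ | |((BinaryCubic.mk a b c d).hessQ : ℝ)| ≤ P}).ncard : ℝ) := by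
          exact_mod_cast Set.ncard_le_ncard hsub (finite_d_hessQ ha b c P)
      _ ≤ 2 * P / (9 * α) + 1 := ncard_d_hessQ_le ha b c hPpos.le
  have hB2 : 27 * (a : ℝ) ^ 2 * X < 4 * P ^ 3 → ((S.ncard : ℕ) : ℝ) ≤ X / (P * Real.sqrt P) + 2 := by
    intro hbig
    have hsub : S ⊆ {d : ℤ | 0 < (BinaryCubic.mk a b c d).disc ∧ ((BinaryCubic.mk a b c d).disc : ℝ) < X} := by
      intro d hd
      obtain ⟨-, -, -, hD, hDX⟩ := hd
      exact ⟨hD, by exact_mod_cast hDX⟩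
    have hfin : {d : ℤ | 0 < (BinaryCubic.mk a b c d).disc ∧ ((BinaryCubic.mk a b c d).disc : ℝ) < X}.Finite :=
      (finite_d_disc_pos ha b c).subset fun d hd => hd.1
    calc ((S.ncard : ℕ) : ℝ)
        ≤ (({d : ℤ | 0 < (BinaryCubic.mk a b c d).disc ∧ ((BinaryCubic.mk a b c d).disc : ℝ) < X}).ncard : ℝ) := by
          exact_mod_cast Set.ncard_le_ncard hsub hfin
      _ ≤ X / (P * Real.sqrt P) + 2 := ncard_d_disc_le ha b c (by positivity) hPdef' hPpos hbig
  -- case analysis at `P* = 4.5 y² β²`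
  set Ps : ℝ := 9 / 2 * y ^ 2 * β ^ 2 with hPs
  have hPs0 : 0 < Ps := by positivity
  rcases le_or_gt P Ps with hle | hgt
  · calc ((S.ncard : ℕ) : ℝ) ≤ 2 * P / (9 * α) + 1 := hB1
      _ ≤ 2 * Ps / (9 * α) + 1 := by gcongr
      _ = y ^ 2 / β ^ 3 + 1 := by rw [hPs, hαβ]; field_simp
      _ ≤ y ^ 2 / β ^ 3 + 2 := by linarith
  · have ha2 : (a : ℝ) ^ 2 = α ^ 2 := by rw [hα, sq_abs]
    have hbig : 27 * (a : ℝ) ^ 2 * X < 4 * P ^ 3 := by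
      rw [ha2, hαβ, hXy]
      have h1 : Ps ^ 3 < P ^ 3 := pow_lt_pow_left₀ hgt hPs0.le (by norm_num)
      have h2 : 27 * (β ^ 5) ^ 2 * y ^ 5 ≤ 27 * β ^ 6 * y ^ 6 := by
        have : 27 * β ^ 6 * y ^ 6 - 27 * (β ^ 5) ^ 2 * y ^ 5 = 27 * (β ^ 6 * y ^ 5) * (y - β ^ 4) := by ring
        nlinarith [mul_pos (pow_pos hβ 6) (pow_pos hy 5), hβy]
      have h3 : 4 * Ps ^ 3 = 729 / 2 * β ^ 6 * y ^ 6 := by rw [hPs]; ring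
      nlinarith [pow_pos hβ 6, pow_pos hy 6]
    have hsPs : Real.sqrt Ps = Real.sqrt (9 / 2) * y * β := by
      rw [hPs, show (9 : ℝ) / 2 * y ^ 2 * β ^ 2 = 9 / 2 * (y * β) ^ 2 by ring,
        Real.sqrt_mul (by norm_num), Real.sqrt_sq (by positivity)]
      ring
    have hs92 : 1 ≤ Real.sqrt (9 / 2) := by
      rw [Real.le_sqrt (by norm_num) (by norm_num)]; norm_num
    have hmono : Ps * Real.sqrt Ps ≤ P * Real.sqrt P :=
      mul_le_mul hgt.le (Real.sqrt_le_sqrt hgt.le) (Real.sqrt_nonneg _) hPpos.le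
    calc ((S.ncard : ℕ) : ℝ) ≤ X / (P * Real.sqrt P) + 2 := hB2 hbig
      _ ≤ X / (Ps * Real.sqrt Ps) + 2 := by
          gcongr
      _ = y ^ 2 / β ^ 3 * (1 / (9 / 2 * Real.sqrt (9 / 2))) + 2 := by
          rw [hsPs, hPs, hXy]
          field_simp
      _ ≤ y ^ 2 / β ^ 3 * 1 + 2 := by
          gcongr
          rw [div_le_one (by positivity)]
          nlinarith
      _ = y ^ 2 / β ^ 3 + 2 := by ring

end BinaryCubic

end Literature.NumberTheory.CubicFields

end
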